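import Literature.AlgebraicGeometry.HodgeTheory.WeilClassesSquareDivisorPolynomial
import Literature.AlgebraicGeometry.HodgeTheory.WeilClassesSixfoldsProofs
import Literature.AlgebraicGeometry.HodgeTheory.WeilClassesDescendingOfLefschetzOneOne
import Literature.AlgebraicGeometry.HodgeTheory.AlgebraicClassesCupAbelianVarietyDiagonal
import Summits.HodgeConjecture.HodgeConjecture.Theorems.WeilTypeLadderOnPath
import HarnessLib

/-!
# The `V₊`-projection criterion: an ALGEBRAIC degree-two class whose `⋀²P₊`-part has non-zero `n`-th power makes
  the Weil classes algebraic — the mechanism of the TYPE-II ANCHOR LOCUS of the non-split cell (WEIL-2 gen 22, door (h′))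

research route, not a corollary; conditional on HC_CM plus one named minimal statement.

Cell `pub-hodge-ring2-ab-*` (ALL ABELIAN VARIETIES), seat WEIL-2, generation 22, account
`run/shared/lean/pub/pub-hodge-ring2/pub-hodge-ring2-ab-weil-2/TYPEII-ANCHOR-G22.md`.  `HC_CM`
(`Theses.RankFourFaces.CMAbelianHodge`) does NOT occur in this file; no named fact, no `sorry`, no definition.

THE MECHANISM (fact-free, on the tree's real carriers).  Let `A` be a complex abelian variety of dimension `2n`,
`φ ≫ φ = -(d • 𝟙 A)` (`K = ℚ(√-d)`, `μ := i√d`), `H¹ = H¹(A(ℂ); ℂ) = V₊ ⊕ V₋` the eigenspaces of `φ^*` for `±μ`.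
The `ℂ`-linear map `P₊ := (2μ)⁻¹ (φ^* + μ)` on `H¹` is the projector onto `V₊` along `V₋`; its exterior square
`x ↦ x₊ := ⋀²P₊ x` (the tree's `exteriorPullback`, the action of the "virtual endomorphism" `(2μ)⁻¹(φ + μ) ∈ End(A) ⊗ ℂ`
on `H²`) extracts the `⋀²V₊`-component of a degree-two class.  THEOREM (`weilClassesOf_le_algebraicClasses_of_plusPart_pow_ne_zero`):
**if `x ∈ H²(A(ℂ); ℂ)` is ALGEBRAIC and `(x₊)^{⌣ n} ≠ 0`, then every Weil class of `(A, φ)` is algebraic**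
(`weilClassesOf A φ n d ≤ algebraicClasses A.X n`).  Proof: (i) `x₊ = a²·φ^*x + (aμ)²·x + a²μ·((φ+𝟙)^*x − φ^*x − x)`,
`a = (2μ)⁻¹` (the degree-two expansion `exteriorPullback_two_eq_of_eq_smul_add_smul` of the tree), and pull-backs along
the endomorphisms `φ`, `𝟙`, `𝟙 + φ` preserve algebraic classes (`map_nsmul_id_add_nsmul_mem_algebraicClasses`), so `x₊`
is algebraic — "the `K`-isotypic components of an algebraic class are algebraic"; (ii) `⋀^{2n}P₊` maps every product
`v₁ ⌣ ⋯ ⌣ v_{2n}` of degree-one classes to the product of the `μ`-eigenvectors `P₊vᵢ`, which lies in the Weil line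
`E₊ = {c : (x·𝟙 + y·φ)^*c = (x + yμ)^{2n} c}` (`cupPowOne_mem_pullbackEigenclasses`), hence maps ALL of `H^{2n}` into `E₊`
(the products span, `HasExteriorCohomologyH1`); by multiplicativity `(x₊)^n = ⋀^{2n}P₊(x^n) ∈ E₊`; (iii) powers of
algebraic classes are algebraic on an abelian variety (`AbelianVariety.cupProduct_mem_algebraicClasses'`); (iv) one
non-zero algebraic Weil class makes the whole plane algebraic (`weilClassesOf_le_algebraicClasses_of_exists_ne_zero`).

WHERE THE HYPOTHESIS HOLDS (prose; account §2–§3).  `x₊ ∈ ⋀²V₊` is a 2-form on the `2n`-space `V₊^*` and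
`(x₊)^n ≠ 0` iff it is NON-DEGENERATE.  On the GENERAL member of a Weil component (`End⁰ = K`) every algebraic
degree-two class is a multiple of the `K`-compatible polarization `h` (`φ^*h = d·h`, i.e. `h ∈ V₊ ∧ V₋`), so `h₊ = 0`:
the criterion is empty there, as it must be.  It is satisfied as soon as `End(A)` contains `ψ` with `φψ = -ψφ`,
`ψ^*` invertible on `H¹`, and `ψ` SYMMETRIC for the Rosati involution of a `K`-compatible polarization `h`: then the
rational divisor class `x := (𝟙+ψ)^*h − h − ψ^*h = 2·h(ψ^*·, ·)` has `x₊ = 2·Σ uⱼ ⌣ ψ^*vⱼ` (`h = Σ uⱼ ⌣ vⱼ`,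
`uⱼ ∈ V₊`, `vⱼ ∈ V₋`), non-degenerate.  This is exactly Albert TYPE II: an indefinite quaternion algebra
`D = K ⊕ Kψ = (-d, b)_ℚ ∋ K` (`ψ² = b > 0`) in `End⁰(A)` with its positive involution of the second kind — e.g. the
6-dimensional PEL family `𝔔(D₆)`, `D₆ = (-3, 2)_ℚ`, of abelian sixfolds with multiplication by a maximal order of `D₆`,
which lies INSIDE the non-split `(ℚ(√-3), (3,3), δ = 2)` cell of the atlas (account §1: its tangent space at
`Y₀ = E_ω⁶` is gen 21's `L(Z₃)`, DOOR-FULL-G21 6.3c; its discriminant is the local invariant of `D₆`), and on which the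
Weil classes are the HARMONIC cubic forms in two anti-compatible divisor classes `a, b`:
`W_K(ℚ) = ⟨a(a−3b)(a+3b), b(a−b)(a+b)⟩` (account §2).  For a DEFINITE quaternion algebra (type III) every `ψ`
anticommuting with `φ` is Rosati-ANTISYMMETRIC, `x = 0`, and the Weil classes are indeed exceptional there (Murty 1984).
In print the conclusion (not the mechanism on these carriers) is Moonen–Zarhin's second criterion (type I/II ⟹ `W_K`
decomposable) and, for the whole Hodge ring, V. K. Murty 1988 Thm. 2 (the tree's `Ring2AtlasTypeIIRows`, modulo the
named fact); the sibling mechanism for `E`-rank-2 sextic fields (type II(3), `m = 1`) is hweil's fact-free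
`WeilTypeLadder.weilClassesOf_le_algebraicClasses_of_rankTwoCMField`.  The present criterion needs no field `E`, no
`ψ`, no polarization on the carriers: only `φ` and one algebraic class.

CONTENTS.  §1 the projector (`map_plusProj_eq_smul`: `φ^*(P₊v) = μ·P₊v`); §2 `x₊` is algebraic
(`exteriorPullback_plusProj_two_mem_algebraicClasses`); §3 `⋀^{2n}P₊ (H^{2n}) ⊆ E₊`
(`exteriorPullback_plusProj_mem_weilClassesPlus`); §4 powers of algebraic degree-two classes
(`cupPowTwo_mem_algebraicClasses`); §5 the criterion (`weilClassesOf_le_algebraicClasses_of_plusPart_pow_ne_zero`);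
§6 the literal body of the rung R1′ `WeilTypeLadder.NonsplitSixfolds` (stmt family of `WeilSixfolds`, the cell
`NonsplitSixfolds` of the ring-2 atlas) on the locus where such an `x` exists
(`nonsplitSixfolds_of_plusPart_pow_ne_zero`, the "no hyperbolic polarization" binder carried unused) and its on-path
lemma (`…_of_nonsplitSixfolds`: a CASE of the rung, hence of the summit).

HONEST LABEL.  A CASE of R1′ on a proper sub-locus (the type-II locus has dimension `n(n+1)/2 = 6` inside the
`n² = 9`-dimensional component for `n = 3`); nothing about the general member; 0 rungs.  New for the tree: the
one-class criterion on the ladder's carriers (before: the `E`-rank-2 mechanism and the product/square mechanisms);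
new for the cell: the identification of the 6-dimensional anchor locus of door (h′) (account).  Not claimed: that
`𝔔(D₆)`'s members satisfy the hypothesis is proved on paper (Rosati symmetry of `β`), not on the carriers.

References: [MoonenZarhin1998WeilClasses] §1–2 (second criterion); [Murty1988] Thm. 2; [Murty1984] Thm. 3.1 and §4
(type III exceptional); [vanGeemen1994HodgeAV] 4.8–4.11, 5.2, 6.12; [Deligne1982HodgeCycles] §4 (4.3)–(4.4), Rem. 4.10;
[Markman2025SurveySecant] §11.5, §12 (the split anchor locus `X × X̂`); [VoisinHodgeII2003] Prop. 9.20.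
-/

noncomputable section

open CategoryTheory
open Literature.AlgebraicGeometry Literature.AlgebraicGeometry.Motives
open Literature.AlgebraicGeometry.HodgeTheory
open Literature.AlgebraicTopology.SingularHomology

namespace Summit.HodgeConjecture.Ring2AbelianAll.NonsplitTypeIIWeilClasses

variable {A : AbelianVariety ℂ} {φ : A ⟶ A} {n d : ℕ}

/-! ## §1 The projector `P₊ = (2μ)⁻¹(φ^* + μ)` onto `V₊` -/

/-- **`φ^*(P₊ v) = μ · P₊ v`**: for `φ ≫ φ = -(d • 𝟙 A)`, `μ = i√d`, and any linear map `P` on `H¹(A(ℂ); ℂ)` with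
`P v = (2μ)⁻¹ • (φ^* v + μ • v)`, the values of `P` are `μ`-eigenvectors of `φ^*` (`(φ^*)² = -d = μ²`, so
`φ^*(φ^*v + μv) = μ(μv + φ^*v)`).  [cite: vanGeemen1994HodgeAV, 4.9 and proof of Lemma 5.2] -/
theorem map_plusProj_mem_eigenspace (hφ : φ ≫ φ = -(d • 𝟙 A))
    {P : complexBetti A.X 1 →ₗ[ℂ] complexBetti A.X 1}
    (hP : ∀ v, P v = (2 * (Complex.I * (Real.sqrt d : ℂ)))⁻¹ •
      (complexBetti.map φ.hom.hom.hom 1 v + (Complex.I * (Real.sqrt d : ℂ)) • v))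
    (v : complexBetti A.X 1) :
    P v ∈ Module.End.eigenspace (complexBetti.map φ.hom.hom.hom 1).hom (Complex.I * (Real.sqrt d : ℂ)) := by
  set μ : ℂ := Complex.I * (Real.sqrt d : ℂ) with hμ
  set F : Module.End ℂ (complexBetti A.X 1) := (complexBetti.map φ.hom.hom.hom 1).hom with hF
  have hμ2 : μ * μ = -(d : ℂ) := by rw [← pow_two, hμ, I_mul_sqrt_sq]
  have hFF : F (F v) = -((d : ℂ) • v) := complexBetti_map_map_one_of_comp_self hφ v
  rw [Module.End.mem_eigenspace_iff]
  have hPv : P v = (2 * μ)⁻¹ • (F v + μ • v) := hP v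
  rw [hPv, map_smul, map_add, map_smul, hFF]
  -- `-(d • v) + μ • F v = μ • (F v + μ • v)`
  have e : -((d : ℂ) • v) + μ • F v = μ • (F v + μ • v) := by
    rw [smul_add, smul_smul, hμ2, neg_smul, add_comm]
  rw [e, smul_comm]

/-! ## §2 The `⋀²V₊`-part of an algebraic degree-two class is algebraic -/

/-- **`x₊ := ⋀²P₊ x` is algebraic when `x` is**: by the degree-two expansion of the exterior pull-back of
`a·φ^* + b·𝟙^*` (`a = (2μ)⁻¹`, `b = aμ`), `x₊ = a²·φ^*x + b²·𝟙^*x + ab·((φ + 𝟙)^*x − φ^*x − 𝟙^*x)`, and pull-backs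
along `x·𝟙 + y·φ` (`x, y ∈ ℕ`) preserve algebraic classes.  ("The `K`-isotypic components of an algebraic class are
algebraic.")  [cite: vanGeemen1994HodgeAV, 4.8 and proof of Thm. 6.12] [cite: Deligne1982HodgeCycles, §4 Remark 4.10] -/
theorem exteriorPullback_plusProj_two_mem_algebraicClasses (hd : 0 < d) (hφ : φ ≫ φ = -(d • 𝟙 A))
    {P : complexBetti A.X 1 →ₗ[ℂ] complexBetti A.X 1}
    (hP : ∀ v, P v = (2 * (Complex.I * (Real.sqrt d : ℂ)))⁻¹ •
      (complexBetti.map φ.hom.hom.hom 1 v + (Complex.I * (Real.sqrt d : ℂ)) • v))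
    {x : complexBetti A.X 2} (hx : x ∈ algebraicClasses A.X 1) :
    exteriorPullback (AbelianVariety.hasExteriorCohomologyH1_complexPoints A) P 2 x ∈ algebraicClasses A.X 1 := by
  set μ : ℂ := Complex.I * (Real.sqrt d : ℂ) with hμ
  set a : ℂ := (2 * μ)⁻¹ with ha
  -- `P = a·φ^* + (aμ)·𝟙^*` on `H¹`
  have hP' : ∀ v, P v = a • complexBetti.map φ.hom.hom.hom 1 v + (a * μ) • complexBetti.map (𝟙 A : A ⟶ A).hom.hom.hom 1 v := by
    intro v
    have h1 : complexBetti.map (𝟙 A : A ⟶ A).hom.hom.hom 1 v = v := abelianVariety_map_id_apply (A := A) v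
    rw [h1, hP v, smul_add, smul_smul]
  rw [exteriorPullback_two_eq_of_eq_smul_add_smul φ (𝟙 A) a (a * μ) hP' x]
  -- the three pull-backs are algebraic
  have hφx : complexBetti.map φ.hom.hom.hom 2 x ∈ algebraicClasses A.X 1 := by
    have h := map_nsmul_id_add_nsmul_mem_algebraicClasses (p := 1) hd hφ 0 1 hx
    simpa only [zero_smul, one_smul, zero_add] using h
  have h1x : complexBetti.map (𝟙 A : A ⟶ A).hom.hom.hom 2 x ∈ algebraicClasses A.X 1 := by
    have h := map_nsmul_id_add_nsmul_mem_algebraicClasses (p := 1) hd hφ 1 0 hx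
    simpa only [zero_smul, one_smul, add_zero] using h
  have hφ1x : complexBetti.map (φ + 𝟙 A).hom.hom.hom 2 x ∈ algebraicClasses A.X 1 := by
    have h := map_nsmul_id_add_nsmul_mem_algebraicClasses (p := 1) hd hφ 1 1 hx
    simp only [one_smul] at h
    rwa [add_comm] at h
  refine Submodule.add_mem _ (Submodule.add_mem _ (Submodule.smul_mem _ _ hφx) (Submodule.smul_mem _ _ h1x))
    (Submodule.smul_mem _ _ ?_)
  exact Submodule.sub_mem _ (Submodule.sub_mem _ hφ1x hφx) h1x

/-! ## §3 `⋀^{2n} P₊` maps `H^{2n}` into the Weil line `E₊` -/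

/-- **`⋀ᵏP₊ (Hᵏ) ⊆ {c : (x·𝟙 + y·φ)^* c = (x + yμ)ᵏ c}`**: every product of degree-one classes goes to the product
of the `μ`-eigenvectors `P₊ vᵢ` (`exteriorPullback_cupPowOne`), an eigenclass of character `(x + yμ)ᵏ`
(`cupPowOne_mem_pullbackEigenclasses`), and such products span `Hᵏ`.  [cite: vanGeemen1994HodgeAV, proof of Thm. 6.12]
[cite: Deligne1982HodgeCycles, §4 (4.3)–(4.4)] -/
theorem exteriorPullback_plusProj_mem_pullbackEigenclasses (hφ : φ ≫ φ = -(d • 𝟙 A))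
    {P : complexBetti A.X 1 →ₗ[ℂ] complexBetti A.X 1}
    (hP : ∀ v, P v = (2 * (Complex.I * (Real.sqrt d : ℂ)))⁻¹ •
      (complexBetti.map φ.hom.hom.hom 1 v + (Complex.I * (Real.sqrt d : ℂ)) • v))
    (k : ℕ) (y : complexBetti A.X k) :
    exteriorPullback (AbelianVariety.hasExteriorCohomologyH1_complexPoints A) P k y ∈
      pullbackEigenclasses A φ k
        (fun a b : ℕ => ((a : ℂ) + (b : ℂ) * (Complex.I * (Real.sqrt d : ℂ))) ^ k) := by
  set hΛ := AbelianVariety.hasExteriorCohomologyH1_complexPoints A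
  set E := pullbackEigenclasses A φ k (fun a b : ℕ => ((a : ℂ) + (b : ℂ) * (Complex.I * (Real.sqrt d : ℂ))) ^ k)
  -- it suffices to check the generators `v₁ ⌣ ⋯ ⌣ v_k`
  suffices h : Submodule.span ℂ (Set.range (cupPowOne ℂ (Motives.ComplexPoints A.X) k)) ≤
      E.comap (exteriorPullback hΛ P k) by
    have hy : y ∈ Submodule.span ℂ (Set.range (cupPowOne ℂ (Motives.ComplexPoints A.X) k)) := by
      rw [hΛ.span_range_cupPowOne k]
      exact Submodule.mem_top
    exact h hy
  refine Submodule.span_le.2 ?_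
  rintro _ ⟨v, rfl⟩
  rw [SetLike.mem_coe, Submodule.mem_comap, exteriorPullback_cupPowOne]
  have hmem := cupPowOne_mem_pullbackEigenclasses (A := A) (φ := φ)
    (lam := fun _ => Complex.I * (Real.sqrt d : ℂ)) (v := fun i => P (v i))
    (fun i => map_plusProj_mem_eigenspace hφ hP (v i))
  have eχ : (fun a b : ℕ => ∏ _i : Fin k, ((a : ℂ) + (b : ℂ) * (Complex.I * (Real.sqrt d : ℂ)))) =
      fun a b : ℕ => ((a : ℂ) + (b : ℂ) * (Complex.I * (Real.sqrt d : ℂ))) ^ k := by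
    funext a b
    rw [Finset.prod_const, Finset.card_univ, Fintype.card_fin]
  rw [eχ] at hmem
  exact hmem

/-- **`⋀^{2n}P₊ (H^{2n}) ⊆ E₊ = weilClassesPlus A φ n d`.** [cite: vanGeemen1994HodgeAV, 4.9 and proof of Thm. 6.12] -/
theorem exteriorPullback_plusProj_mem_weilClassesPlus (hφ : φ ≫ φ = -(d • 𝟙 A))
    {P : complexBetti A.X 1 →ₗ[ℂ] complexBetti A.X 1}
    (hP : ∀ v, P v = (2 * (Complex.I * (Real.sqrt d : ℂ)))⁻¹ •
      (complexBetti.map φ.hom.hom.hom 1 v + (Complex.I * (Real.sqrt d : ℂ)) • v))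
    (y : complexBetti A.X (2 * n)) :
    exteriorPullback (AbelianVariety.hasExteriorCohomologyH1_complexPoints A) P (2 * n) y ∈
      weilClassesPlus A φ n d := by
  have h := exteriorPullback_plusProj_mem_pullbackEigenclasses hφ hP (2 * n) y
  have eχ : (fun a b : ℕ => ((a : ℂ) + (b : ℂ) * (Complex.I * (Real.sqrt d : ℂ))) ^ (2 * n)) =
      fun a b : ℕ => ((a : ℂ) + (b : ℂ) * Complex.I * (Real.sqrt d : ℂ)) ^ (2 * n) := by
    funext a b; rw [mul_assoc]
  rw [eχ] at h
  exact h

/-! ## §4 Powers of algebraic degree-two classes -/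

/-- **`xⁱ` is algebraic when `x ∈ H²` is**, on a complex abelian variety (products of algebraic classes are
algebraic, Voisin II Prop. 9.20, a tree theorem).  [cite: VoisinHodgeII2003, Prop. 9.20] -/
theorem cupPowTwo_mem_algebraicClasses (A : AbelianVariety ℂ) {x : complexBetti A.X 2}
    (hx : x ∈ algebraicClasses A.X 1) : ∀ i : ℕ, cupPowTwo x i ∈ algebraicClasses A.X i
  | 0 => by
    rw [cupPowTwo_zero, algebraicClasses_zero]
    exact Submodule.mem_top
  | i + 1 => by
    rw [cupPowTwo_succ]
    exact AbelianVariety.cupProduct_mem_algebraicClasses' A (l := i) (k := 1) (p := i + 1) (two_mul_add_two i)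
      (cupPowTwo_mem_algebraicClasses A hx i) hx

/-! ## §5 The criterion -/

/-- **THE `V₊`-PROJECTION CRITERION.**  `A` a complex abelian variety of dimension `2n` (`n ≥ 1`),
`φ ≫ φ = -(d • 𝟙 A)` (`d ≥ 1`, `K = ℚ(√-d)`, `μ = i√d`), `P` the linear map `v ↦ (2μ)⁻¹(φ^*v + μv)` on
`H¹(A(ℂ); ℂ)` (the projector onto `V₊ = ker(φ^* − μ)`), `x ∈ H²(A(ℂ); ℂ)` an ALGEBRAIC class (`x ∈ N¹H²`).  If the
`n`-th cup power of `x₊ := ⋀²P x` is non-zero, then EVERY Weil class of `(A, φ)` is algebraic: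
`weilClassesOf A φ n d ≤ algebraicClasses A.X n`.  (`x₊` is algebraic, §2; `(x₊)^n = ⋀^{2n}P(x^n)` lies in the Weil
line `E₊`, §3, and is algebraic, §4; one non-zero algebraic Weil class suffices,
`weilClassesOf_le_algebraicClasses_of_exists_ne_zero`.)  Satisfied on the type-II loci (a Rosati-symmetric
invertible `ψ` anticommuting with `φ`, `x = (𝟙+ψ)^*h − h − ψ^*h`); empty on the general member and at type-III points
(module docstring).  [cite: MoonenZarhin1998WeilClasses, §1–2 (second criterion)] [cite: vanGeemen1994HodgeAV, 4.8–4.11, 6.12]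
[cite: Deligne1982HodgeCycles, §4 Remark 4.10] [cite: VoisinHodgeII2003, Prop. 9.20] -/
theorem weilClassesOf_le_algebraicClasses_of_plusPart_pow_ne_zero (hn : 0 < n) (hd : 0 < d)
    (hA : A.dim = 2 * n) (hφ : φ ≫ φ = -(d • 𝟙 A))
    {P : complexBetti A.X 1 →ₗ[ℂ] complexBetti A.X 1}
    (hP : ∀ v, P v = (2 * (Complex.I * (Real.sqrt d : ℂ)))⁻¹ •
      (complexBetti.map φ.hom.hom.hom 1 v + (Complex.I * (Real.sqrt d : ℂ)) • v))
    {x : complexBetti A.X 2} (hx : x ∈ algebraicClasses A.X 1)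
    (hne : cupPowTwo (exteriorPullback (AbelianVariety.hasExteriorCohomologyH1_complexPoints A) P 2 x) n ≠ 0) :
    weilClassesOf A φ n d ≤ algebraicClasses A.X n := by
  set hΛ := AbelianVariety.hasExteriorCohomologyH1_complexPoints A
  have hb₁ : Module.finrank ℂ (complexBetti A.X 1) = 2 * (2 * n) := by
    rw [AbelianVariety.finrank_complexBetti_one, hA]
  set ω := cupPowTwo (exteriorPullback hΛ P 2 x) n with hω
  -- `ω = ⋀^{2n}P (x^n) ∈ E₊`
  have hωE : ω ∈ weilClassesPlus A φ n d := by
    rw [hω, ← exteriorPullback_cupPowTwo hΛ P x n]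
    exact exteriorPullback_plusProj_mem_weilClassesPlus hφ hP (cupPowTwo x n)
  have hωW : ω ∈ weilClassesOf A φ n d := weilClassesPlus_le_weilClassesOf A φ n d hωE
  -- `ω` is algebraic
  have hωalg : ω ∈ algebraicClasses A.X n :=
    cupPowTwo_mem_algebraicClasses A (exteriorPullback_plusProj_two_mem_algebraicClasses hd hφ hP hx) n
  exact weilClassesOf_le_algebraicClasses_of_exists_ne_zero hn hd hφ hΛ hb₁ ⟨ω, hωW, hωalg, hne⟩

/-! ## §6 The rung R1′ `NonsplitSixfolds` on the locus, and its on-path lemma -/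

open Summit.HodgeConjecture.HodgeConjecture.WeilTypeLadder in
/-- **The literal body of R1′ (`WeilTypeLadder.NonsplitSixfolds`, non-split Weil sixfolds) ON THE LOCUS where an
algebraic degree-two class with `(x₊)^{⌣3} ≠ 0` exists** — e.g. the 6-dimensional type-II family `𝔔(D₆)` inside the
`(ℚ(√-3), (3,3), δ = 2)` cell (account §1–§3; the verification that its members carry such an `x` is on paper).
The rung's binders are carried verbatim (the "no hyperbolic `K`-symmetrised hyperplane class" one unused) with the
locus hypothesis inserted after them; fact-free.  [cite: Markman2025SurveySecant, §11.5 Step 1 and §12]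
[cite: MoonenZarhin1998WeilClasses, §2] -/
theorem nonsplitSixfolds_of_plusPart_pow_ne_zero :
    ∀ (d : ℕ), 0 < d → ∀ (A : Motives.AbelianVariety ℂ) (φ : A ⟶ A), A.dim = 2 * 3 →
      Motives.IsSmoothProjective (2 * 3) A.X → φ ≫ φ = -(d • 𝟙 A) →
        (∀ (e : Motives.ProjectiveEmbedding A.X) (a : complexBetti (Motives.projectiveSpace e.n ℂ) 2),
          IsRationalClass a → a ≠ 0 →
            ¬ Motives.IsHyperbolicWeilType A φ 3
              ((d : ℂ) • complexBetti.map e.ι 2 a +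
                complexBetti.map φ.hom.hom.hom 2 (complexBetti.map e.ι 2 a))) →
        (∃ (P : complexBetti A.X 1 →ₗ[ℂ] complexBetti A.X 1) (x : complexBetti A.X 2),
          (∀ v, P v = (2 * (Complex.I * (Real.sqrt d : ℂ)))⁻¹ •
            (complexBetti.map φ.hom.hom.hom 1 v + (Complex.I * (Real.sqrt d : ℂ)) • v)) ∧
          x ∈ algebraicClasses A.X 1 ∧
          cupPowTwo (exteriorPullback (AbelianVariety.hasExteriorCohomologyH1_complexPoints A) P 2 x) 3 ≠ 0) →
        ∀ c : complexBetti A.X (2 * 3), IsRationalClass c → IsOfHodgeType (2 * 3) A.X (2 * 3) 3 3 c →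
          c ∈ weilClassesOf A φ 3 d → c ∈ algebraicClasses A.X 3 := by
  intro d hd A φ hA _ hφ _ hloc c _ _ hc
  obtain ⟨P, x, hP, hx, hne⟩ := hloc
  exact weilClassesOf_le_algebraicClasses_of_plusPart_pow_ne_zero (n := 3) (by norm_num) hd hA hφ hP hx hne hc

open Summit.HodgeConjecture.HodgeConjecture.WeilTypeLadder in
/-- **ON PATH: the locus statement is a CASE of the rung R1′** (drop the locus hypothesis), hence of the summit
(`WeilTypeLadder.nonsplitSixfolds_of_hodgeConjecture`).  Bookkeeping only: nothing here is stronger than the Clay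
statement.  [cite: Markman2025SurveySecant, §12] -/
theorem nonsplitSixfolds_of_plusPart_pow_ne_zero_of_nonsplitSixfolds (h : NonsplitSixfolds) :
    ∀ (d : ℕ), 0 < d → ∀ (A : Motives.AbelianVariety ℂ) (φ : A ⟶ A), A.dim = 2 * 3 →
      Motives.IsSmoothProjective (2 * 3) A.X → φ ≫ φ = -(d • 𝟙 A) →
        (∀ (e : Motives.ProjectiveEmbedding A.X) (a : complexBetti (Motives.projectiveSpace e.n ℂ) 2),
          IsRationalClass a → a ≠ 0 →
            ¬ Motives.IsHyperbolicWeilType A φ 3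
              ((d : ℂ) • complexBetti.map e.ι 2 a +
                complexBetti.map φ.hom.hom.hom 2 (complexBetti.map e.ι 2 a))) →
        (∃ (P : complexBetti A.X 1 →ₗ[ℂ] complexBetti A.X 1) (x : complexBetti A.X 2),
          (∀ v, P v = (2 * (Complex.I * (Real.sqrt d : ℂ)))⁻¹ •
            (complexBetti.map φ.hom.hom.hom 1 v + (Complex.I * (Real.sqrt d : ℂ)) • v)) ∧
          x ∈ algebraicClasses A.X 1 ∧
          cupPowTwo (exteriorPullback (AbelianVariety.hasExteriorCohomologyH1_complexPoints A) P 2 x) 3 ≠ 0) →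
        ∀ c : complexBetti A.X (2 * 3), IsRationalClass c → IsOfHodgeType (2 * 3) A.X (2 * 3) 3 3 c →
          c ∈ weilClassesOf A φ 3 d → c ∈ algebraicClasses A.X 3 :=
  fun d hd A φ hA hX hφ hnh _ c hcQ hct hc => h d hd A φ hA hX hφ hnh c hcQ hct hc

/-- The summit implies the locus statement (through R1′).  [cite: Markman2025SurveySecant, §12] -/
theorem nonsplitSixfolds_of_plusPart_pow_ne_zero_of_hodgeConjecture (h : _root_.HodgeConjecture) :
    ∀ (d : ℕ), 0 < d → ∀ (A : Motives.AbelianVariety ℂ) (φ : A ⟶ A), A.dim = 2 * 3 →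
      Motives.IsSmoothProjective (2 * 3) A.X → φ ≫ φ = -(d • 𝟙 A) →
        (∀ (e : Motives.ProjectiveEmbedding A.X) (a : complexBetti (Motives.projectiveSpace e.n ℂ) 2),
          IsRationalClass a → a ≠ 0 →
            ¬ Motives.IsHyperbolicWeilType A φ 3
              ((d : ℂ) • complexBetti.map e.ι 2 a +
                complexBetti.map φ.hom.hom.hom 2 (complexBetti.map e.ι 2 a))) →
        (∃ (P : complexBetti A.X 1 →ₗ[ℂ] complexBetti A.X 1) (x : complexBetti A.X 2),
          (∀ v, P v = (2 * (Complex.I * (Real.sqrt d : ℂ)))⁻¹ •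
            (complexBetti.map φ.hom.hom.hom 1 v + (Complex.I * (Real.sqrt d : ℂ)) • v)) ∧
          x ∈ algebraicClasses A.X 1 ∧
          cupPowTwo (exteriorPullback (AbelianVariety.hasExteriorCohomologyH1_complexPoints A) P 2 x) 3 ≠ 0) →
        ∀ c : complexBetti A.X (2 * 3), IsRationalClass c → IsOfHodgeType (2 * 3) A.X (2 * 3) 3 3 c →
          c ∈ weilClassesOf A φ 3 d → c ∈ algebraicClasses A.X 3 :=
  nonsplitSixfolds_of_plusPart_pow_ne_zero_of_nonsplitSixfolds
    (Summit.HodgeConjecture.HodgeConjecture.WeilTypeLadder.nonsplitSixfolds_of_hodgeConjecture h)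

end Summit.HodgeConjecture.Ring2AbelianAll.NonsplitTypeIIWeilClasses

end
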